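import Summits.QuantumFields.YangMills.Theorems.BalabanUVNodesN15PerCubeGreenSopCloseScaled
import Summits.QuantumFields.YangMills.Theorems.BalabanUVNodesN15PerCubeGreenCovariantGradientClose
import Summits.QuantumFields.YangMills.Theorems.BalabanUVNodesN15PerCubeGreenLandauCov
import Summits.QuantumFields.YangMills.Theorems.BalabanUVNodesN15CovariantLandauMinimizers
import HarnessLib

/-!
# N15 = NE2, road (c) — PROGRAMME (PC), (PC-D) «the per-cube LANDAU LETTER», II: THE MINIMIZER GRADIENT `E(U) = D_UG′(U)Q′(U)ᵀ` (n15-c∕212 `cE`, fine coloured 1-forms ← coarse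
# coloured scalars) — ITS ROWS at the scale `(L^k)^{−(d+1)}` for `U` and for the flat field, and ITS CLOSENESS `E(U) − E(𝟙) ≤ B(L^k)^{−(d+1)}(Σ(r_V) + σ + (L^m)⁻¹ + e^{−δd_Z(y)})e^{−δd}`
# for `U` (3.35)-small in the trivial gauge on the two-collar boxes of the near cubes and in Bałaban's class on the far ones (dag-n15-c g29, n15-c∕307)

Cell `pub-ymgap`, seat `pub-ymgap-dag-n15-c` (generation g29; R134 (a), s1; HUMAN RULING D-0062).  `bears_on: R4∕N15 · K3⁸ SpineGivenEndpointR13SepCoPHV (stmt-QuantumFields-27366)`;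
filed `--kind proof --supports stmt-QuantumFields-27366 --as helper` — COUNT-NEUTRAL.  One theorem, 0 `sorry`, 0 `def`.  The bookkeeping (geometry of the cover, the SITE letter of
`Q′(U)ᵀ − Q′(𝟙)ᵀ`: `σ(r_V)` on the blocks of near cubes, `|ι| + 1` on far blocks where `d_Z = 0`) is COPIED from the TREE text of n15-c∕299a `…PerCubeGreenSopCloseScaled` with the (3.35)
data on the two-collar boxes; entry 2 of (3.42) comes from n15-c∕278 (rows) and n15-c∕305 (closeness), assembled on bonds by n15-c∕299h `hasMaj_bond_of_pull`; the two compositions are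
n15-c∕297 `hasMaj_nfW_comp_exp` ∕ `hasMaj_comp_nfW` (Lipschitz `d_Z`).  Imports 299a, 305, 299h, 212 BY NAME.  Nothing in the tree is modified.

WHY.  n15-c∕212 `landauCov_sub_factorised`: `D(I−R)Dᵀ(U) − D(I−R)Dᵀ(𝟙) = (E−E₁)S⁻¹Eᵀ + E₁(S⁻¹−S₁⁻¹)Eᵀ + E₁S₁⁻¹(E−E₁)ᵀ`; with n15-c∕213∕306 (`A·C·Bᵀ` rows from the rows of the
fine-indexed factors) the per-cube Landau letter needs exactly: rows of `E`, `E₁` and of `E − E₁` (THIS FILE), rows of `S⁻¹` (n15-c∕299e) and of `S⁻¹ − S₁⁻¹` (n15-c∕299a∕299i).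
No adjoint entry of (3.42) is used.

HONEST FRAMING ∕ LIMITS.  MODEL carriers (the cover of n15-c∕260 on the doubled unit torus); composition of LANDED theorems; [B9] (3.34)–(3.35) p.396, (3.42) p.397, (3.49) p.399,
Cor. 3.8 p.410, (3.95)–(3.96) p.411 cited for SHAPES ∕ MECHANISM, NOT the printed statements.  NE2⁺ NOT PRINTED, NOT proved; N15 of record untouched (DISCHARGED AS CONSUMED,
p687738); K3⁸ OPEN; counts of record UNMOVED; one finite 𝕋⁴ at fixed ε per index — NOT infinite volume, NOT OS on ℝ⁴, NOT a mass gap, NOT Clay.  Restate-immune (no Theses import).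
-/

noncomputable section

open scoped BigOperators Matrix Matrix.Norms.L2Operator

namespace Summit.QuantumFields.YangMills.BalabanUVNodes.N15.Gluing

open Real
open Literature.MathematicalPhysics.QuantumFieldTheory.Balaban1983to89
open Literature.MathematicalPhysics.QuantumFieldTheory.Balaban1983to89.B5Prop11Plancherel (Tor fine unitVec)
open Literature.MathematicalPhysics.QuantumFieldTheory.Balaban1983to89.B11SectG (BlockNorm HasMaj RowSum hasMaj_zero)
open Literature.MathematicalPhysics.QuantumFieldTheory.Balaban1983to89.B6RandomWalk (Triangle254)
open Literature.MathematicalPhysics.QuantumFieldTheory.Balaban1983to89.B6Prop26Gluing (mulOp)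
open Literature.MathematicalPhysics.QuantumFieldTheory.Balaban1983to89.B6UnitTorusCarrier (unitTorusGeo triangle254_unitTorusGeo rowSum_unitTorusGeo unitTorusGeo_dist_nonneg unitTorusGeo_dist_self)
open Literature.MathematicalPhysics.QuantumFieldTheory.Balaban1983to89.B9Eq335RegularityClasses (Reg335Cube)
open Literature.MathematicalPhysics.QuantumFieldTheory.Balaban1983to89.B9Eq3117Current (gaugeTr gaugeTr_apply)
open Literature.MathematicalPhysics.QuantumFieldTheory.Balaban1983to89.B9Eq39Adjoint (covD fluct)
open Literature.MathematicalPhysics.QuantumFieldTheory.Balaban1983to89.B9BackgroundsKLevelV1 (fluct_zero)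
open Summit.QuantumFields.YangMills.BalabanUVNodes.N15.CovLandau (claplA cGreen cSop csavg cgrad cE hasMaj_csavg hasMaj_csavg_transpose hasMaj_csavg_sub_at hasMaj_csavg_sub_transpose_at mulVecLin_sub')
open Literature.MathematicalPhysics.QuantumFieldTheory.Balaban1983to89.T4EtaRateCoeffDefect (pull)
open Summit.QuantumFields.YangMills.BalabanUVNodes.N15.CovAvg (cvaStair cvaStair_one)
open Summit.QuantumFields.YangMills.BalabanUVNodes.N15.BackgroundModel (kappa_ofBlocks)
open Summit.QuantumFields.YangMills.BalabanUVNodes.N15.DefectKernel (kingBlockOf_bpt)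
open Literature.MathematicalPhysics.QuantumFieldTheory.Balaban1983to89.B5Block118 (bpt)
open Literature.MathematicalPhysics.QuantumFieldTheory.Balaban1983to89.B9Eq335PureGaugeInClassAtLettersY (reg335Cube_gaugeTr_one)
open Literature.MathematicalPhysics.QuantumFieldTheory.King1986 (aK aK_pos aK_le)
open Literature.MathematicalPhysics.QuantumFieldTheory.King1986.Torus (blockOf)
open Literature.Barriers.QuantumFields (traceForm)
open Summit.QuantumFields.YangMills.BalabanUVNodes.N15.BackgroundLayer (covLapM tCoefA tCoefC)
open Summit.QuantumFields.YangMills.BalabanUVNodes.N15.VectorPiece (bshiftEquiv bshiftEquiv_apply)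
open Summit.QuantumFields.YangMills.BalabanUVNodes.N15.MatrixSpecies (mmulOp coordMat basisConst liftEquiv liftBlk)
open Summit.QuantumFields.YangMills.BalabanUVNodes.N15.TwoGrid (chiCube cubeBlocks hasMaj_smul_ofBlocks)
open Summit.QuantumFields.YangMills.BalabanUVNodes.N15.CurvedSpecies (gaugePair uN_exists_gauge_cutCoefLetters_of_reg335Cube uN_localCoefLetters_of_gauge335)

variable {d : ℕ}

section Green

variable {L : ℕ} [NeZero L]

set_option maxHeartbeats 800000 in

/-- ★★★ **THE MINIMIZER GRADIENT `E(U) = D_UG′(U)Q′(U)ᵀ`: ROWS AND CLOSENESS TO THE FLAT ONE, FROM (3.35) DATA**: for `(d, L, a₀, ι)` there are `δ, w₀, R₀, B` such that at every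
index `(m, k)` with `L^m ≥ w₀`, for `Far ∕ Z ∕ d_Z` (`d_Z ≥ 0` a Lipschitz minorant of the distance to `Z ⊇` the far regions) and a `U(m)` field `U` (3.35)-small in the TRIVIAL gauge on the
two-collar boxes of the cubes not `Far`, in Bałaban's class on those of the far cubes, letters `r_V ≥` the two (3.35) bounds, `r_V(1+|J⊕J|) + a₀|ι|(|ι|σ² + 2σ) ≤ R₀`:
(i) `mulVecLin (cE (cvT e U) a_K) ≤ B(L^k)^{−(d+1)}e^{−δd}` (coarse scalars → fine 1-forms), (ii) the same for the flat field, (iii)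
`mulVecLin (cE (cvT e U) a_K) − mulVecLin (cE 𝟙 a_K) ≤ B(L^k)^{−(d+1)}(r_V(1+|J⊕J|) + R_N + σ + (L^m)⁻¹ + e^{−δd_Z(y)})e^{−δ|y−y′|_T}`.  MODEL carriers; SHAPES of [B9] (3.42) ∕ (3.49) ∕ Cor. 3.8.
[cite: Balaban1985BackgroundPropagators, (3.42) p.397, (3.49) p.399, (3.19) p.393, (3.34)–(3.35) p.396, Cor. 3.8 p.410, (3.95)–(3.96) p.411 (shape ∕ mechanism); Balaban1984PropagatorsI, (1.20) p.20] -/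
theorem hasMaj_cE_sub_of_reg335 (hL : Odd L ∧ 1 < L) (hL7 : 7 ≤ L) {a₀ : ℝ} (ha₀ : 0 < a₀) (ι : Type) [Fintype ι] [DecidableEq ι] :
    ∃ δ w₀ R₀ B : ℝ, 0 < δ ∧ 0 < R₀ ∧ 0 < B ∧
      ∀ (mv kk : ℕ), 1 ≤ kk → w₀ ≤ ((L ^ mv : ℕ) : ℝ) →
      ∀ {mm : Type} [Fintype mm] [DecidableEq mm] [Nonempty mm] (e : Matrix mm mm ℂ ≃L[ℝ] (ι → ℝ)), (∀ A B : Matrix mm mm ℂ, traceForm A B = e A ⬝ᵥ e B) →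
      ∀ (Far : (Fin (d + 1) → ZMod (2 * L)) → Prop) [DecidablePred Far] (Z : Set (Tor (cvM d L mv kk hL))) (dZ : Tor (cvM d L mv kk hL) → ℝ),
        (∀ y z, z ∈ Z → dZ y ≤ (unitTorusGeo L kk (cvM d L mv kk hL)).dist y z) → (∀ y, 0 ≤ dZ y) → (∀ y z, dZ y ≤ (unitTorusGeo L kk (cvM d L mv kk hL)).dist y z + dZ z) →
        (∀ k, Far k → cvSk d L mv kk hL k ⊆ Z) →
      ∀ (U : Fin (d + 1) → ScX d L mv kk hL → (Matrix mm mm ℂ)ˣ), (∀ μ x, (U μ x : Matrix mm mm ℂ) ∈ Matrix.unitaryGroup mm ℂ) →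
      ∀ (ξ C : ℝ), 0 < ξ → 0 < C →
        (∀ k, Far k → Reg335Cube (scShift d L mv kk hL) U ((((L ^ kk : ℕ) : ℝ))⁻¹) {x : ScX d L mv kk hL | blockOf (L ^ kk) (cvM d L mv kk hL) x ∈ cubeBlocks (cvM d L mv kk hL) (coverCorner (cvM d L mv kk hL) (L ^ mv) L (2 * L ^ mv + 2) k) (6 * L ^ mv + 5)} ξ C) →
        (∀ k, ¬Far k → ∃ A : Fin (d + 1) → ScX d L mv kk hL → Matrix mm mm ℂ, (∀ μ, ∀ z ∈ {x : ScX d L mv kk hL | blockOf (L ^ kk) (cvM d L mv kk hL) x ∈ cubeBlocks (cvM d L mv kk hL) (coverCorner (cvM d L mv kk hL) (L ^ mv) L (2 * L ^ mv + 2) k) (6 * L ^ mv + 5)}, gaugeTr (scShift d L mv kk hL) (fun _ => (1 : (Matrix mm mm ℂ)ˣ)) U μ z = fluct ((((L ^ kk : ℕ) : ℝ))⁻¹) A μ z) ∧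
          (∀ μ, ∀ z ∈ {x : ScX d L mv kk hL | blockOf (L ^ kk) (cvM d L mv kk hL) x ∈ cubeBlocks (cvM d L mv kk hL) (coverCorner (cvM d L mv kk hL) (L ^ mv) L (2 * L ^ mv + 2) k) (6 * L ^ mv + 5)}, ‖A μ z‖ < C * ξ⁻¹) ∧ (∀ μ ν, ∀ z ∈ {x : ScX d L mv kk hL | blockOf (L ^ kk) (cvM d L mv kk hL) x ∈ cubeBlocks (cvM d L mv kk hL) (coverCorner (cvM d L mv kk hL) (L ^ mv) L (2 * L ^ mv + 2) k) (6 * L ^ mv + 5)}, ‖((↑((((L ^ kk : ℕ) : ℝ))⁻¹) : ℂ)⁻¹) • covD (scShift d L mv kk hL) (fun _ _ => (1 : (Matrix mm mm ℂ)ˣ)) μ (A ν) z‖ < C * (ξ ^ 2)⁻¹)) →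
      ∀ (rV : ℝ), 0 ≤ rV →
        Fintype.card ι * (@basisConst ι _ (Matrix mm mm ℂ) Matrix.frobeniusNormedAddCommGroup Matrix.frobeniusNormedSpace e * (2 * Real.sqrt (Fintype.card mm)) * (Real.sqrt (Fintype.card mm) * ((C / ξ) * Real.exp (((((L ^ kk : ℕ) : ℝ))⁻¹) * (C / ξ))))) ≤ rV →
        Fintype.card ι * (Fintype.card (Fin (d + 1)) * (Fintype.card ι * (@basisConst ι _ (Matrix mm mm ℂ) Matrix.frobeniusNormedAddCommGroup Matrix.frobeniusNormedSpace e * (2 * Real.sqrt (Fintype.card mm)) * (Real.sqrt (Fintype.card mm) * ((C / ξ) * Real.exp (((((L ^ kk : ℕ) : ℝ))⁻¹) * (C / ξ))))) ^ 2 + @basisConst ι _ (Matrix mm mm ℂ) Matrix.frobeniusNormedAddCommGroup Matrix.frobeniusNormedSpace e * (2 * Real.sqrt (Fintype.card mm)) * (Real.sqrt (Fintype.card mm) * ((C / ξ ^ 2) * Real.exp (((((L ^ kk : ℕ) : ℝ))⁻¹) * (C / ξ)))))) ≤ rV →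
        rV * (1 + Fintype.card (Fin (d + 1) ⊕ Fin (d + 1))) + a₀ * (Fintype.card ι * (Fintype.card ι * ((1 + rV * ((((L ^ kk : ℕ) : ℝ))⁻¹)) ^ ((d + 1) * L ^ kk) - 1) ^ 2 + 2 * ((1 + rV * ((((L ^ kk : ℕ) : ℝ))⁻¹)) ^ ((d + 1) * L ^ kk) - 1))) ≤ R₀ →
        HasMaj (BlockNorm.ofBlocks (unitTorusGeo L kk (cvM d L mv kk hL)) (liftBlk (fun y : Tor (cvM d L mv kk hL) => y) ι)) (BlockNorm.ofBlocks (unitTorusGeo L kk (cvM d L mv kk hL)) (liftBlk (fun b : ScX d L mv kk hL × Fin (d + 1) => blockOf (L ^ kk) (cvM d L mv kk hL) b.1) ι)) (Matrix.mulVecLin (cE (cvM d L mv kk hL) (L ^ kk) (cvT e (fun μ x => (U μ x : Matrix mm mm ℂ))) (aK a₀ (L : ℝ) kk * (((L ^ kk : ℕ) : ℝ)) ^ (d + 1)))) (fun y y' => B * ((((L ^ kk : ℕ) : ℝ)) ^ (d + 1))⁻¹ * Real.exp (-(δ * (unitTorusGeo L kk (cvM d L mv kk hL)).dist y y'))) 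∧
        HasMaj (BlockNorm.ofBlocks (unitTorusGeo L kk (cvM d L mv kk hL)) (liftBlk (fun y : Tor (cvM d L mv kk hL) => y) ι)) (BlockNorm.ofBlocks (unitTorusGeo L kk (cvM d L mv kk hL)) (liftBlk (fun b : ScX d L mv kk hL × Fin (d + 1) => blockOf (L ^ kk) (cvM d L mv kk hL) b.1) ι)) (Matrix.mulVecLin (cE (cvM d L mv kk hL) (L ^ kk) (fun (_ : Fin (d + 1)) (_ : ScX d L mv kk hL) => (1 : Matrix ι ι ℝ)) (aK a₀ (L : ℝ) kk * (((L ^ kk : ℕ) : ℝ)) ^ (d + 1)))) (fun y y' => B * ((((L ^ kk : ℕ) : ℝ)) ^ (d + 1))⁻¹ * Real.exp (-(δ * (unitTorusGeo L kk (cvM d L mv kk hL)).dist y y'))) ∧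
        HasMaj (BlockNorm.ofBlocks (unitTorusGeo L kk (cvM d L mv kk hL)) (liftBlk (fun y : Tor (cvM d L mv kk hL) => y) ι)) (BlockNorm.ofBlocks (unitTorusGeo L kk (cvM d L mv kk hL)) (liftBlk (fun b : ScX d L mv kk hL × Fin (d + 1) => blockOf (L ^ kk) (cvM d L mv kk hL) b.1) ι)) (Matrix.mulVecLin (cE (cvM d L mv kk hL) (L ^ kk) (cvT e (fun μ x => (U μ x : Matrix mm mm ℂ))) (aK a₀ (L : ℝ) kk * (((L ^ kk : ℕ) : ℝ)) ^ (d + 1))) - Matrix.mulVecLin (cE (cvM d L mv kk hL) (L ^ kk) (fun (_ : Fin (d + 1)) (_ : ScX d L mv kk hL) => (1 : Matrix ι ι ℝ)) (aK a₀ (L : ℝ) kk * (((L ^ kk : ℕ) : ℝ)) ^ (d + 1))))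
          (fun y y' => B * ((((L ^ kk : ℕ) : ℝ)) ^ (d + 1))⁻¹ * (rV * (1 + Fintype.card (Fin (d + 1) ⊕ Fin (d + 1))) + aK a₀ (L : ℝ) kk * (Fintype.card ι * (Fintype.card ι * ((1 + rV * ((((L ^ kk : ℕ) : ℝ))⁻¹)) ^ ((d + 1) * L ^ kk) - 1) ^ 2 + 2 * ((1 + rV * ((((L ^ kk : ℕ) : ℝ))⁻¹)) ^ ((d + 1) * L ^ kk) - 1))) + ((1 + rV * ((((L ^ kk : ℕ) : ℝ))⁻¹)) ^ ((d + 1) * L ^ kk) - 1) + (((L ^ mv : ℕ) : ℝ))⁻¹ + Real.exp (-(δ * dZ y))) * Real.exp (-(δ * (unitTorusGeo L kk (cvM d L mv kk hL)).dist y y'))) := by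
  classical
  obtain ⟨δ₁, w₁, R₁, B₁, cR₁, hδ₁, hR₁, hB₁, hcR₁, H₁⟩ := hasMaj_cgradGreen_sub_of_reg335 (d := d) hL hL7 ha₀ ι
  obtain ⟨δ₆, w₆, R₆, B₀₆, B₆, cJ, hδ₆, hR₆, hB₀₆, hB₆, hcJ, H₆⟩ := hasMaj_cGreen_jet_of_reg335Box2 (d := d) hL hL7 ha₀ ι
  -- rates: common decay `δ₀`, weight∕row-sum `m`, two convolution steps
  set δ₀ : ℝ := min (δ₁ / 64) (δ₆ / 16) with hδ₀def
  have hδ₀ : 0 < δ₀ := lt_min (by positivity) (by positivity)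
  have hδ₀₁ : δ₀ ≤ δ₁ / 64 := min_le_left _ _
  have hδ₀₆ : δ₀ ≤ δ₆ / 16 := min_le_right _ _
  set m : ℝ := min (δ₀ / 8) (3 * δ₁ / 128) with hmdef
  have hm : 0 < m := lt_min (by positivity) (by positivity)
  have hm8 : m ≤ δ₀ / 8 := min_le_left _ _
  have hmc : m ≤ 3 * δ₁ / 128 := min_le_right _ _
  set cr : ℝ := B4Sect5Proof.latticeConst (d + 1) m with hcrdef
  have hcr0 : 0 ≤ cr := B4Sect5Proof.latticeConst_nonneg (d + 1) hm.le
  set τ : ℝ := (Fintype.card ι : ℝ) + 1 with hτdef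
  have hτ0 : 0 ≤ τ := by positivity
  -- the constants: entry 2's row `B_L` (for `r_V ≤ 1`), its closeness letter `B_C`, the two compositions (all block norms have `κ = 1`)
  set BL : ℝ := (1 * (1 + 1 * cJ) + π) * B₆ with hBL
  set BC : ℝ := B₁ * ((1 + Real.exp δ₁ * cR₁ + π) + Real.exp δ₁) with hBC
  set K₁ : ℝ := 1 * BL * τ * cr with hK₁
  set K₂ : ℝ := 1 * BC * τ * cr with hK₂
  set K₃ : ℝ := 1 * BL * 1 * cr with hK₃
  set Bout : ℝ := K₁ + K₂ + K₃ * (τ + 1) + 1 with hBout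
  have hBL0 : 0 ≤ BL := by rw [hBL]; positivity
  have hBC0 : 0 ≤ BC := by rw [hBC]; positivity
  refine ⟨m, max (max w₁ w₆) 2, min (min R₁ R₆) 1, Bout, hm, lt_min (lt_min hR₁ hR₆) one_pos, by positivity, fun mv kk hk hw₀ => ?_⟩
  intro mm _ _ _ e he Far _ Z dZ hdZ hdZ0 hdZl hZ U hU ξ C hξ hC hfar hnear rV hrV hrA hrC hRle
  have hw₁ : w₁ ≤ ((L ^ mv : ℕ) : ℝ) := ((le_max_left _ _).trans (le_max_left _ _)).trans hw₀
  have hw₆ : w₆ ≤ ((L ^ mv : ℕ) : ℝ) := ((le_max_right _ _).trans (le_max_left _ _)).trans hw₀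
  have hW2 : 2 ≤ L ^ mv := by have h := (le_max_right (max w₁ w₆) 2).trans hw₀; exact_mod_cast h
  have hRle₁ : rV * (1 + Fintype.card (Fin (d + 1) ⊕ Fin (d + 1))) + a₀ * (Fintype.card ι * (Fintype.card ι * ((1 + rV * ((((L ^ kk : ℕ) : ℝ))⁻¹)) ^ ((d + 1) * L ^ kk) - 1) ^ 2 + 2 * ((1 + rV * ((((L ^ kk : ℕ) : ℝ))⁻¹)) ^ ((d + 1) * L ^ kk) - 1))) ≤ R₁ := hRle.trans ((min_le_left _ _).trans (min_le_left _ _))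
  have hRle₆ : rV * (1 + Fintype.card (Fin (d + 1) ⊕ Fin (d + 1))) + a₀ * (Fintype.card ι * (Fintype.card ι * ((1 + rV * ((((L ^ kk : ℕ) : ℝ))⁻¹)) ^ ((d + 1) * L ^ kk) - 1) ^ 2 + 2 * ((1 + rV * ((((L ^ kk : ℕ) : ℝ))⁻¹)) ^ ((d + 1) * L ^ kk) - 1))) ≤ R₆ := hRle.trans ((min_le_left _ _).trans (min_le_right _ _))
  have hU' : ∀ μ x, ((U μ x : Matrix mm mm ℂ))ᴴ * (U μ x : Matrix mm mm ℂ) = 1 := fun μ x => Matrix.mem_unitaryGroup_iff'.mp (hU μ x)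
  have hη : (0 : ℝ) < ((((L ^ kk : ℕ) : ℝ))⁻¹) := inv_pos.mpr (Nat.cast_pos.mpr (pow_pos (Nat.pos_of_ne_zero (NeZero.ne L)) kk))
  have hη1 : ((((L ^ kk : ℕ) : ℝ))⁻¹) ≤ 1 := inv_le_one_of_one_le₀ (by exact_mod_cast Nat.one_le_pow _ _ (Nat.pos_of_ne_zero (NeZero.ne L)))
  have hL1r : (1 : ℝ) < (L : ℝ) := by exact_mod_cast hL.2
  have ha' : 0 < (aK a₀ (L : ℝ) kk * (((L ^ kk : ℕ) : ℝ)) ^ (d + 1)) := mul_pos (aK_pos ha₀ hL1r hk) (by positivity)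
  -- geometry
  have htri : Triangle254 (unitTorusGeo L kk (cvM d L mv kk hL)) := triangle254_unitTorusGeo L kk _
  have hd : ∀ a b : Tor (cvM d L mv kk hL), 0 ≤ (unitTorusGeo L kk (cvM d L mv kk hL)).dist a b := unitTorusGeo_dist_nonneg L kk _
  have hd0 : ∀ y : Tor (cvM d L mv kk hL), (unitTorusGeo L kk (cvM d L mv kk hL)).dist y y = 0 := unitTorusGeo_dist_self L kk _
  have hrow : RowSum (unitTorusGeo L kk (cvM d L mv kk hL)) m cr := by rw [hcrdef]; exact rowSum_unitTorusGeo L kk _ hm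
  -- (3.35) on EVERY box for `U` (near: the trivial datum IS a class datum) and for the flat field
  have hone : ∀ z : ScX d L mv kk hL, ‖(((fun (_ : ScX d L mv kk hL) => (1 : (Matrix mm mm ℂ)ˣ)) z : (Matrix mm mm ℂ)ˣ) : Matrix mm mm ℂ)‖ ≤ 1 ∧
      ‖((((fun (_ : ScX d L mv kk hL) => (1 : (Matrix mm mm ℂ)ˣ)) z)⁻¹ : (Matrix mm mm ℂ)ˣ) : Matrix mm mm ℂ)‖ ≤ 1 :=
    fun z => by simp only [Units.val_one, inv_one]; exact ⟨norm_one.le, norm_one.le⟩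
  have h335 : ∀ k, Reg335Cube (scShift d L mv kk hL) U ((((L ^ kk : ℕ) : ℝ))⁻¹) {x : ScX d L mv kk hL | blockOf (L ^ kk) (cvM d L mv kk hL) x ∈ cubeBlocks (cvM d L mv kk hL) (coverCorner (cvM d L mv kk hL) (L ^ mv) L (2 * L ^ mv + 2) k) (6 * L ^ mv + 5)} ξ C := fun k => by
    by_cases hk : Far k
    · exact hfar k hk
    · obtain ⟨A, hg, hA, hD⟩ := hnear k hk
      exact ⟨fun _ => 1, A, fun z _ => hone z, hg, hA, hD⟩
  have h335one : ∀ k, Reg335Cube (scShift d L mv kk hL) (fun (_ : Fin (d + 1)) (_ : ScX d L mv kk hL) => (1 : (Matrix mm mm ℂ)ˣ)) ((((L ^ kk : ℕ) : ℝ))⁻¹) {x : ScX d L mv kk hL | blockOf (L ^ kk) (cvM d L mv kk hL) x ∈ cubeBlocks (cvM d L mv kk hL) (coverCorner (cvM d L mv kk hL) (L ^ mv) L (2 * L ^ mv + 2) k) (6 * L ^ mv + 5)} ξ C := fun k => by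
    have h := reg335Cube_gaugeTr_one (scShift d L mv kk hL) (η := ((((L ^ kk : ℕ) : ℝ))⁻¹)) {x : ScX d L mv kk hL | blockOf (L ^ kk) (cvM d L mv kk hL) x ∈ cubeBlocks (cvM d L mv kk hL) (coverCorner (cvM d L mv kk hL) (L ^ mv) L (2 * L ^ mv + 2) k) (6 * L ^ mv + 5)} hξ hC (fun (_ : ScX d L mv kk hL) => (1 : (Matrix mm mm ℂ)ˣ)) (fun z _ => hone z)
    have hg : gaugeTr (scShift d L mv kk hL) (fun (_ : ScX d L mv kk hL) => (1 : (Matrix mm mm ℂ)ˣ)) (fun (_ : Fin (d + 1)) (_ : ScX d L mv kk hL) => (1 : (Matrix mm mm ℂ)ˣ)) =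
        fun (_ : Fin (d + 1)) (_ : ScX d L mv kk hL) => (1 : (Matrix mm mm ℂ)ˣ) := by
      funext μ x; rw [gaugeTr_apply, inv_one, mul_one, mul_one]
    rwa [hg] at h
  have h1U : ∀ (μ : Fin (d + 1)) (x : ScX d L mv kk hL), (((fun (_ : Fin (d + 1)) (_ : ScX d L mv kk hL) => (1 : (Matrix mm mm ℂ)ˣ)) μ x : (Matrix mm mm ℂ)ˣ) : Matrix mm mm ℂ) ∈ Matrix.unitaryGroup mm ℂ :=
    fun μ x => by simp only [Units.val_one]; exact Submonoid.one_mem _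
  -- the common rate
  have hrate : ∀ ⦃c ρ ρ' : ℝ⦄, 0 ≤ c → ρ' ≤ ρ → ∀ y y' : Tor (cvM d L mv kk hL), c * Real.exp (-(ρ * (unitTorusGeo L kk (cvM d L mv kk hL)).dist y y')) ≤ c * Real.exp (-(ρ' * (unitTorusGeo L kk (cvM d L mv kk hL)).dist y y')) :=
    fun c ρ ρ' hc hρ y y' => mul_le_mul_of_nonneg_left (Real.exp_le_exp.mpr (by nlinarith only [hd y y', hρ])) hc
  -- `r_V ≤ 1` from the smallness hypothesis (`R₀ ≤ 1`)
  have hηrV : 0 ≤ rV * ((((L ^ kk : ℕ) : ℝ))⁻¹) := mul_nonneg hrV hη.le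
  have hSIG0 : 0 ≤ ((1 + rV * ((((L ^ kk : ℕ) : ℝ))⁻¹)) ^ ((d + 1) * L ^ kk) - 1) := by
    have := one_le_pow₀ (M₀ := ℝ) (a := 1 + rV * ((((L ^ kk : ℕ) : ℝ))⁻¹)) (le_add_of_nonneg_right hηrV) (n := (d + 1) * L ^ kk); linarith only [this]
  have hRC0 : 0 ≤ rV * (1 + Fintype.card (Fin (d + 1) ⊕ Fin (d + 1))) := mul_nonneg hrV (add_nonneg zero_le_one (Nat.cast_nonneg _))
  have hRN0 : 0 ≤ aK a₀ (L : ℝ) kk * (Fintype.card ι * (Fintype.card ι * ((1 + rV * ((((L ^ kk : ℕ) : ℝ))⁻¹)) ^ ((d + 1) * L ^ kk) - 1) ^ 2 + 2 * ((1 + rV * ((((L ^ kk : ℕ) : ℝ))⁻¹)) ^ ((d + 1) * L ^ kk) - 1))) := by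
    have := aK_pos ha₀ hL1r hk
    exact mul_nonneg this.le (mul_nonneg (Nat.cast_nonneg _) (add_nonneg (by positivity) (mul_nonneg zero_le_two hSIG0)))
  have hW0 : 0 ≤ (((L ^ mv : ℕ) : ℝ))⁻¹ := inv_nonneg.2 (Nat.cast_nonneg _)
  have hrV1 : rV ≤ 1 := by
    have h1 := hRle.trans (min_le_right _ _)
    have h2 : 0 ≤ a₀ * (Fintype.card ι * (Fintype.card ι * ((1 + rV * ((((L ^ kk : ℕ) : ℝ))⁻¹)) ^ ((d + 1) * L ^ kk) - 1) ^ 2 + 2 * ((1 + rV * ((((L ^ kk : ℕ) : ℝ))⁻¹)) ^ ((d + 1) * L ^ kk) - 1))) := mul_nonneg ha₀.le (mul_nonneg (Nat.cast_nonneg _) (add_nonneg (by positivity) (mul_nonneg zero_le_two hSIG0)))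
    have h3 : rV ≤ rV * (1 + Fintype.card (Fin (d + 1) ⊕ Fin (d + 1))) := le_mul_of_one_le_right hrV (le_add_of_nonneg_right (Nat.cast_nonneg _))
    linarith only [h1, h2, h3]
  have hnpos : (0 : ℝ) < ((((L ^ kk : ℕ) : ℝ)) ^ (d + 1)) := by positivity
  -- the cover's windows (n15-c∕262's geometry): `h_k(x) ≠ 0 ⟹ χ_k(x) = 1`, `χ_k(x) ≠ 0 ⟹ B(x) ∈ □_k`
  have hM : ∀ ν, cvM d L mv kk hL ν = 2 * L * L ^ mv := MP_succ_eq L mv kk hL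
  have hw : 0 < L ^ mv := by omega
  have hlo : (2 : ℝ) * ((L ^ mv : ℕ) : ℝ) ≤ ((2 * L ^ mv : ℕ) : ℝ) := by push_cast; exact le_rfl
  have hhi : ((2 * L ^ mv : ℕ) : ℝ) + ((L ^ mv : ℕ) : ℝ) + (2 + 1) * ((L ^ mv : ℕ) : ℝ) + 1 ≤ ((6 * L ^ mv + 1 : ℕ) : ℝ) := by push_cast; linarith only []
  have hS6 : 6 * L ^ mv + 1 ≤ 2 * L * L ^ mv := by
    have h7 : 7 * L ^ mv ≤ L * L ^ mv := Nat.mul_le_mul_right _ hL7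
    have e : 2 * L * L ^ mv = 2 * (L * L ^ mv) := by ring
    rw [e]; omega
  have hm₁ : 2 * L ^ mv ≤ coverMargin L mv := two_mul_le_coverMargin hL7 mv
  have hfitI : coverMargin L mv - 2 * L ^ mv + (6 * L ^ mv + 1) ≤ L * L ^ mv := coverMargin_inner_fit hL7 hW2
  have hS0 : L * L ^ mv ≤ 2 * L * L ^ mv := by rw [mul_assoc]; omega
  have hK2 : 2 ≤ 2 * L := by omega
  have hwin : ∀ (k : Fin (d + 1) → ZMod (2 * L)) (x : ScX d L mv kk hL), scH d L mv kk hL k x ≠ 0 → scChi d L mv kk hL k x = 1 := fun k x hx =>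
    scChi_lift_eq_one_of_near_bbox (ι := Unit) 2 hM hw hlo hhi hS6 0 k (x, ())
      ⟨(x, ()), Or.inl rfl, fun ν => (abs_cenRep_lt_one_of_hcube_ne_zero (K := 2 * L) (ξ := scXi d L mv kk hL) hx ν).trans (by norm_num)⟩
  have hcover : ∀ x : ScX d L mv kk hL, ∃ k : Fin (d + 1) → ZMod (2 * L), scH d L mv kk hL k x ≠ 0 := fun x => by
    by_contra h
    push Not at h
    have h1 := sum_hcube_sq (2 * L) (scXi d L mv kk hL) hK2 x
    rw [Finset.sum_eq_zero (fun k _ => by rw [show hcube (2 * L) (scXi d L mv kk hL) k x = 0 from h k, zero_pow two_ne_zero])] at h1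
    exact zero_ne_one h1
  have hblk : ∀ (k : Fin (d + 1) → ZMod (2 * L)) (x x' : ScX d L mv kk hL), blockOf (L ^ kk) (cvM d L mv kk hL) x' = blockOf (L ^ kk) (cvM d L mv kk hL) x →
      scChi d L mv kk hL k x' = scChi d L mv kk hL k x := fun k x x' h => by
    simp only [scChi, chiCube, h]
  have hS5 : 6 * L ^ mv + 5 ≤ 2 * L * L ^ mv := by
    have h7 : 7 * L ^ mv ≤ L * L ^ mv := Nat.mul_le_mul_right _ hL7
    have e2 : 2 * L * L ^ mv = 2 * (L * L ^ mv) := by ring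
    rw [e2]; omega
  have hin : ∀ k (x : ScX d L mv kk hL), x ∈ {x : ScX d L mv kk hL | blockOf (L ^ kk) (cvM d L mv kk hL) x ∈ cubeBlocks (cvM d L mv kk hL) (coverCorner (cvM d L mv kk hL) (L ^ mv) L (2 * L ^ mv + 1) k) (6 * L ^ mv + 3)} → x ∈ {x : ScX d L mv kk hL | blockOf (L ^ kk) (cvM d L mv kk hL) x ∈ cubeBlocks (cvM d L mv kk hL) (coverCorner (cvM d L mv kk hL) (L ^ mv) L (2 * L ^ mv + 2) k) (6 * L ^ mv + 5)} := fun k x hx =>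
    mem_cubeBlocks_of_mem_inner (m₀ := 2 * L ^ mv + 2) (S₀ := 6 * L ^ mv + 5) hM (by omega) (by omega) hS5 hx
  -- entry 2 of (3.42) (n15-c∕278) for `U` and for the flat field, assembled on the bond carrier (n15-c∕299h §1), at the common rate
  have hL2 : HasMaj (ScNorm d L mv kk hL ι) (BlockNorm.ofBlocks (unitTorusGeo L kk (cvM d L mv kk hL)) (liftBlk (fun b : ScX d L mv kk hL × Fin (d + 1) => blockOf (L ^ kk) (cvM d L mv kk hL) b.1) ι)) (Matrix.mulVecLin (cgrad (cvM d L mv kk hL) (L ^ kk) (cvT e (fun μ x => (U μ x : Matrix mm mm ℂ))) * cGreen (cvM d L mv kk hL) (L ^ kk) (cvT e (fun μ x => (U μ x : Matrix mm mm ℂ))) (aK a₀ (L : ℝ) kk * (((L ^ kk : ℕ) : ℝ)) ^ (d + 1)))) (fun y y' => BL * Real.exp (-(δ₀ * (unitTorusGeo L kk (cvM d L mv kk hL)).dist y y'))) := by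
    obtain ⟨-, h2⟩ := H₆ mv kk hk hw₆ e he U hU ξ C hξ hC.le h335 rV hrV hrA hrC hRle₆
    refine hasMaj_bond_of_pull (g := unitTorusGeo L kk (cvM d L mv kk hL)) (scBlk d L mv kk hL) (fun y y' => by positivity) fun μ => (h2 μ).mono fun y y' => ?_
    have hc : (1 * (1 + rV * cJ) + π) * B₆ ≤ BL := by
      have : rV * cJ ≤ 1 * cJ := mul_le_mul_of_nonneg_right hrV1 hcJ
      rw [hBL]; exact mul_le_mul_of_nonneg_right (by linarith only [this]) hB₆.le
    exact (mul_le_mul_of_nonneg_right hc (Real.exp_nonneg _)).trans (hrate hBL0 hδ₀₆ y y')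
  have hL2₁ : HasMaj (ScNorm d L mv kk hL ι) (BlockNorm.ofBlocks (unitTorusGeo L kk (cvM d L mv kk hL)) (liftBlk (fun b : ScX d L mv kk hL × Fin (d + 1) => blockOf (L ^ kk) (cvM d L mv kk hL) b.1) ι)) (Matrix.mulVecLin (cgrad (cvM d L mv kk hL) (L ^ kk) (fun (_ : Fin (d + 1)) (_ : ScX d L mv kk hL) => (1 : Matrix ι ι ℝ)) * cGreen (cvM d L mv kk hL) (L ^ kk) (fun (_ : Fin (d + 1)) (_ : ScX d L mv kk hL) => (1 : Matrix ι ι ℝ)) (aK a₀ (L : ℝ) kk * (((L ^ kk : ℕ) : ℝ)) ^ (d + 1)))) (fun y y' => BL * Real.exp (-(δ₀ * (unitTorusGeo L kk (cvM d L mv kk hL)).dist y y'))) := by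
    obtain ⟨-, h2⟩ := H₆ mv kk hk hw₆ e he (fun (_ : Fin (d + 1)) (_ : ScX d L mv kk hL) => (1 : (Matrix mm mm ℂ)ˣ)) h1U ξ C hξ hC.le h335one rV hrV hrA hrC hRle₆
    rw [show (fun μ x => (((fun (_ : Fin (d + 1)) (_ : ScX d L mv kk hL) => (1 : (Matrix mm mm ℂ)ˣ)) μ x : (Matrix mm mm ℂ)ˣ) : Matrix mm mm ℂ)) = fun _ _ => (1 : Matrix mm mm ℂ) from funext fun _ => funext fun _ => Units.val_one, cvT_one e] at h2
    refine hasMaj_bond_of_pull (g := unitTorusGeo L kk (cvM d L mv kk hL)) (scBlk d L mv kk hL) (fun y y' => by positivity) fun μ => (h2 μ).mono fun y y' => ?_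
    have hc : (1 * (1 + rV * cJ) + π) * B₆ ≤ BL := by
      have : rV * cJ ≤ 1 * cJ := mul_le_mul_of_nonneg_right hrV1 hcJ
      rw [hBL]; exact mul_le_mul_of_nonneg_right (by linarith only [this]) hB₆.le
    exact (mul_le_mul_of_nonneg_right hc (Real.exp_nonneg _)).trans (hrate hBL0 hδ₀₆ y y')
  -- the CLOSENESS of entry 2 (n15-c∕305), on bonds, in n15-c∕297's weighted currency
  have hLL : HasMaj (ScNorm d L mv kk hL ι) (BlockNorm.ofBlocks (unitTorusGeo L kk (cvM d L mv kk hL)) (liftBlk (fun b : ScX d L mv kk hL × Fin (d + 1) => blockOf (L ^ kk) (cvM d L mv kk hL) b.1) ι)) (Matrix.mulVecLin (cgrad (cvM d L mv kk hL) (L ^ kk) (cvT e (fun μ x => (U μ x : Matrix mm mm ℂ))) * cGreen (cvM d L mv kk hL) (L ^ kk) (cvT e (fun μ x => (U μ x : Matrix mm mm ℂ))) (aK a₀ (L : ℝ) kk * (((L ^ kk : ℕ) : ℝ)) ^ (d + 1))) - Matrix.mulVecLin (cgrad (cvM d L mv kk hL) (L ^ kk) (fun (_ : Fin (d + 1)) (_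 : ScX d L mv kk hL) => (1 : Matrix ι ι ℝ)) * cGreen (cvM d L mv kk hL) (L ^ kk) (fun (_ : Fin (d + 1)) (_ : ScX d L mv kk hL) => (1 : Matrix ι ι ℝ)) (aK a₀ (L : ℝ) kk * (((L ^ kk : ℕ) : ℝ)) ^ (d + 1))))
      (fun y y' => ((rV * (1 + Fintype.card (Fin (d + 1) ⊕ Fin (d + 1))) + aK a₀ (L : ℝ) kk * (Fintype.card ι * (Fintype.card ι * ((1 + rV * ((((L ^ kk : ℕ) : ℝ))⁻¹)) ^ ((d + 1) * L ^ kk) - 1) ^ 2 + 2 * ((1 + rV * ((((L ^ kk : ℕ) : ℝ))⁻¹)) ^ ((d + 1) * L ^ kk) - 1))) + (((L ^ mv : ℕ) : ℝ))⁻¹) + 1 * Real.exp (-((3 * δ₁ / 128) * dZ y))) * (BC * Real.exp (-(δ₀ * (unitTorusGeo L kk (cvM d L mv kk hL)).dist y y')))) := by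
    have h1 := H₁ mv kk hk hw₁ e he Far Z dZ hdZ hdZ0 hZ U hU ξ C hξ hC hfar hnear rV hrV hrA hrC hRle₁
    refine hasMaj_bond_of_pull (g := unitTorusGeo L kk (cvM d L mv kk hL)) (scBlk d L mv kk hL) (fun y y' => by positivity) fun μ => ?_
    rw [LinearMap.comp_sub]
    refine (h1 μ).mono fun y y' => ?_
    have hexp : Real.exp (-(δ₁ / 64 * (unitTorusGeo L kk (cvM d L mv kk hL)).dist y y')) ≤ Real.exp (-(δ₀ * (unitTorusGeo L kk (cvM d L mv kk hL)).dist y y')) := Real.exp_le_exp.mpr (by nlinarith only [hd y y', hδ₀₁])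
    have hX0 : 0 ≤ rV * (1 + Fintype.card (Fin (d + 1) ⊕ Fin (d + 1))) + aK a₀ (L : ℝ) kk * (Fintype.card ι * (Fintype.card ι * ((1 + rV * ((((L ^ kk : ℕ) : ℝ))⁻¹)) ^ ((d + 1) * L ^ kk) - 1) ^ 2 + 2 * ((1 + rV * ((((L ^ kk : ℕ) : ℝ))⁻¹)) ^ ((d + 1) * L ^ kk) - 1))) + (((L ^ mv : ℕ) : ℝ))⁻¹ + Real.exp (-(3 * δ₁ / 128 * dZ y)) := by positivity
    have hκ : 1 * (1 + rV * Real.exp δ₁ * cR₁) + π ≤ 1 + Real.exp δ₁ * cR₁ + π := by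
      have : rV * Real.exp δ₁ * cR₁ ≤ 1 * Real.exp δ₁ * cR₁ := mul_le_mul_of_nonneg_right (mul_le_mul_of_nonneg_right hrV1 (Real.exp_nonneg _)) hcR₁
      linarith only [this]
    have hr : 1 * (rV * Real.exp δ₁) ≤ Real.exp δ₁ * (rV * (1 + Fintype.card (Fin (d + 1) ⊕ Fin (d + 1))) + aK a₀ (L : ℝ) kk * (Fintype.card ι * (Fintype.card ι * ((1 + rV * ((((L ^ kk : ℕ) : ℝ))⁻¹)) ^ ((d + 1) * L ^ kk) - 1) ^ 2 + 2 * ((1 + rV * ((((L ^ kk : ℕ) : ℝ))⁻¹)) ^ ((d + 1) * L ^ kk) - 1))) + (((L ^ mv : ℕ) : ℝ))⁻¹ + Real.exp (-(3 * δ₁ / 128 * dZ y))) := by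
      have h3 : rV ≤ rV * (1 + Fintype.card (Fin (d + 1) ⊕ Fin (d + 1))) := le_mul_of_one_le_right hrV (le_add_of_nonneg_right (Nat.cast_nonneg _))
      have h4 : rV * (1 + Fintype.card (Fin (d + 1) ⊕ Fin (d + 1))) ≤ rV * (1 + Fintype.card (Fin (d + 1) ⊕ Fin (d + 1))) + aK a₀ (L : ℝ) kk * (Fintype.card ι * (Fintype.card ι * ((1 + rV * ((((L ^ kk : ℕ) : ℝ))⁻¹)) ^ ((d + 1) * L ^ kk) - 1) ^ 2 + 2 * ((1 + rV * ((((L ^ kk : ℕ) : ℝ))⁻¹)) ^ ((d + 1) * L ^ kk) - 1))) + (((L ^ mv : ℕ) : ℝ))⁻¹ + Real.exp (-(3 * δ₁ / 128 * dZ y)) := by linarith only [Real.exp_nonneg (-(3 * δ₁ / 128 * dZ y)), hRN0, hW0]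
      calc 1 * (rV * Real.exp δ₁) = Real.exp δ₁ * rV := by ring
        _ ≤ _ := mul_le_mul_of_nonneg_left (h3.trans h4) (Real.exp_nonneg _)
    calc B₁ * ((1 * (1 + rV * Real.exp δ₁ * cR₁) + π) * (rV * (1 + Fintype.card (Fin (d + 1) ⊕ Fin (d + 1))) + aK a₀ (L : ℝ) kk * (Fintype.card ι * (Fintype.card ι * ((1 + rV * ((((L ^ kk : ℕ) : ℝ))⁻¹)) ^ ((d + 1) * L ^ kk) - 1) ^ 2 + 2 * ((1 + rV * ((((L ^ kk : ℕ) : ℝ))⁻¹)) ^ ((d + 1) * L ^ kk) - 1))) + (((L ^ mv : ℕ) : ℝ))⁻¹ + Real.exp (-(3 * δ₁ / 128 * dZ y))) + 1 * (rV * Real.exp δ₁)) * Real.exp (-(δ₁ / 64 * (unitTorusGeo L kk (cvM d L mv kk hL)).dist y y'))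
        ≤ B₁ * ((1 + Real.exp δ₁ * cR₁ + π) * (rV * (1 + Fintype.card (Fin (d + 1) ⊕ Fin (d + 1))) + aK a₀ (L : ℝ) kk * (Fintype.card ι * (Fintype.card ι * ((1 + rV * ((((L ^ kk : ℕ) : ℝ))⁻¹)) ^ ((d + 1) * L ^ kk) - 1) ^ 2 + 2 * ((1 + rV * ((((L ^ kk : ℕ) : ℝ))⁻¹)) ^ ((d + 1) * L ^ kk) - 1))) + (((L ^ mv : ℕ) : ℝ))⁻¹ + Real.exp (-(3 * δ₁ / 128 * dZ y))) + Real.exp δ₁ * (rV * (1 + Fintype.card (Fin (d + 1) ⊕ Fin (d + 1))) + aK a₀ (L : ℝ) kk * (Fintype.card ι * (Fintype.card ι * ((1 + rV * ((((L ^ kk : ℕ) : ℝ))⁻¹)) ^ ((d + 1) * L ^ kk) - 1) ^ 2 + 2 * ((1 + rV * ((((L ^ kk : ℕ) : ℝ))⁻¹)) ^ ((d + 1) * L ^ kk) - 1))) + (((L ^ mv : ℕ) : ℝ))⁻¹ + Real.exp (-(3 * δ₁ / 128 * dZ y)))) * Real.exp (-(δ₀ * (unitTorusGeo L kk (cvM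 d L mv kk hL)).dist y y')) :=
          mul_le_mul (mul_le_mul_of_nonneg_left (add_le_add (mul_le_mul_of_nonneg_right hκ hX0) hr) hB₁.le) hexp (Real.exp_nonneg _) (mul_nonneg hB₁.le (by positivity))
      _ = _ := by rw [hBC]; ring
  -- the transposed block averagings `Q′(U)ᵀ`, `Q′(𝟙)ᵀ` (coarse → fine scalars; block-diagonal rows at the scale `(L^k)^{−(d+1)}`, letter `τ = |ι| + 1`)
  have hR : HasMaj (BlockNorm.ofBlocks (unitTorusGeo L kk (cvM d L mv kk hL)) (liftBlk (fun y : Tor (cvM d L mv kk hL) => y) ι)) (ScNorm d L mv kk hL ι) (Matrix.mulVecLin (csavg (cvM d L mv kk hL) (L ^ kk) (cvT e (fun μ x => (U μ x : Matrix mm mm ℂ))))ᵀ) (fun y y' => (((((L ^ kk : ℕ) : ℝ)) ^ (d + 1))⁻¹ * τ) * Real.exp (-(δ₀ * (unitTorusGeo L kk (cvM d L mv kk hL)).dist y y'))) := by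
    have h := hasMaj_csavg_transpose (cvM d L mv kk hL) (L ^ kk) L kk (cvT e (fun μ x => (U μ x : Matrix mm mm ℂ))) (τ := Fintype.card ι) (Nat.cast_nonneg _)
      fun y a i => cols_cvaStair_cvT_le (cvM d L mv kk hL) (L ^ kk) e he hU' y a 0 i
    refine (HasMaj.diag_const_exp δ₀ hd0 (by positivity) h).mono fun y y' => mul_le_mul_of_nonneg_right ?_ (Real.exp_nonneg _)
    exact mul_le_mul_of_nonneg_left (by rw [hτdef]; linarith only []) (inv_nonneg.2 hnpos.le)
  have hR₁ : HasMaj (BlockNorm.ofBlocks (unitTorusGeo L kk (cvM d L mv kk hL)) (liftBlk (fun y : Tor (cvM d L mv kk hL) => y) ι)) (ScNorm d L mv kk hL ι) (Matrix.mulVecLin (csavg (cvM d L mv kk hL) (L ^ kk) (fun (_ : Fin (d + 1)) (_ : ScX d L mv kk hL) => (1 : Matrix ι ι ℝ)))ᵀ) (fun y y' => (((((L ^ kk : ℕ) : ℝ)) ^ (d + 1))⁻¹ * τ) * Real.exp (-(δ₀ * (unitTorusGeo L kk (cvM d L mv kk hL)).dist y y'))) := by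
    have h := hasMaj_csavg_transpose (cvM d L mv kk hL) (L ^ kk) L kk (fun (_ : Fin (d + 1)) (_ : ScX d L mv kk hL) => (1 : Matrix ι ι ℝ)) (τ := 1) zero_le_one fun y a i => by
      rw [cvaStair_one]
      exact le_of_eq (by simp only [Matrix.one_apply, apply_ite abs, abs_one, abs_zero, Finset.sum_ite_eq', Finset.mem_univ, if_true])
    refine (HasMaj.diag_const_exp δ₀ hd0 (by positivity) h).mono fun y y' => mul_le_mul_of_nonneg_right ?_ (Real.exp_nonneg _)
    exact mul_le_mul_of_nonneg_left (by rw [hτdef]; linarith only [Nat.cast_nonneg (α := ℝ) (Fintype.card ι)]) (inv_nonneg.2 hnpos.le)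
  -- the block letter of the staircase of `T = cvT e U` minus `1`: near blocks by the datum, far blocks in `Z`
  have hletter : ∀ (y : Tor (cvM d L mv kk hL)) (a : Fin (d + 1) → Fin (L ^ kk)),
      (∀ i, ∑ j, |(cvaStair (cvM d L mv kk hL) (L ^ kk) (fun μ b => cvT e (fun μ x => (U μ x : Matrix mm mm ℂ)) μ b.1) y a 0 - cvaStair (cvM d L mv kk hL) (L ^ kk) (fun μ b => (fun (_ : Fin (d + 1)) (_ : ScX d L mv kk hL) => (1 : Matrix ι ι ℝ)) μ b.1) y a 0) i j| ≤ (if dZ y = 0 then ((1 + rV * ((((L ^ kk : ℕ) : ℝ))⁻¹)) ^ ((d + 1) * L ^ kk) - 1) + ((Fintype.card ι : ℝ) + 1) else ((1 + rV * ((((L ^ kk : ℕ) : ℝ))⁻¹)) ^ ((d + 1) * L ^ kk) - 1))) ∧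
      (∀ j, ∑ i, |(cvaStair (cvM d L mv kk hL) (L ^ kk) (fun μ b => cvT e (fun μ x => (U μ x : Matrix mm mm ℂ)) μ b.1) y a 0 - cvaStair (cvM d L mv kk hL) (L ^ kk) (fun μ b => (fun (_ : Fin (d + 1)) (_ : ScX d L mv kk hL) => (1 : Matrix ι ι ℝ)) μ b.1) y a 0) i j| ≤ (if dZ y = 0 then ((1 + rV * ((((L ^ kk : ℕ) : ℝ))⁻¹)) ^ ((d + 1) * L ^ kk) - 1) + ((Fintype.card ι : ℝ) + 1) else ((1 + rV * ((((L ^ kk : ℕ) : ℝ))⁻¹)) ^ ((d + 1) * L ^ kk) - 1))) := fun y a => by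
    have hbx : blockOf (L ^ kk) (cvM d L mv kk hL) (bpt (L ^ kk) (cvM d L mv kk hL) y a) = y := kingBlockOf_bpt _ _ y a
    obtain ⟨k, hkx⟩ := hcover (bpt (L ^ kk) (cvM d L mv kk hL) y a)
    have hχ : scChi d L mv kk hL k (bpt (L ^ kk) (cvM d L mv kk hL) y a) ≠ 0 := by rw [hwin k _ hkx]; exact one_ne_zero
    by_cases hk : Far k
    · -- far: the block lies in `Z`, `d_Z(y) = 0`, and the crude letter `|ι| + 1`
      have hyZ : y ∈ Z := by
        have h := Finset.mem_coe.mpr (blockOf_mem_cubeBlocks_of_inner_ne_zero hM hm₁ hfitI hS0 hχ)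
        rw [hbx] at h
        exact hZ k hk h
      have hdy : dZ y = 0 := le_antisymm (by have := hdZ y y hyZ; rwa [hd0] at this) (hdZ0 y)
      rw [if_pos hdy]
      obtain ⟨hr, hc⟩ := rows_cols_cvaStair_cvT_sub_one_le ι e he hU' y a 0
      exact ⟨fun i => (hr i).trans (by linarith only [hSIG0]), fun j => (hc j).trans (by linarith only [hSIG0])⟩
    · -- near: every site of the block carries the trivial datum of cube `k`
      obtain ⟨A, hg, hA, hD⟩ := hnear k hk
      have hT : ∀ μ x', blockOf (L ^ kk) (cvM d L mv kk hL) x' = y →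
          (∀ i, ∑ j, |(cvT e (fun μ x => (U μ x : Matrix mm mm ℂ)) μ x' - 1) i j| ≤ rV * ((((L ^ kk : ℕ) : ℝ))⁻¹)) ∧ ∀ j, ∑ i, |(cvT e (fun μ x => (U μ x : Matrix mm mm ℂ)) μ x' - 1) i j| ≤ rV * ((((L ^ kk : ℕ) : ℝ))⁻¹) := fun μ x' hx' => by
        have hχ' : scChi d L mv kk hL k x' ≠ 0 := by rw [hblk k _ x' (hx'.trans hbx.symm)]; exact hχ
        have hQ := hin k x' (scChi_ne_zero_nbhd hL hL7 mv kk k x' hχ').1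
        obtain ⟨hr, hc⟩ := rows_cols_cvT_sub_one_le_of_datum ι e (scShift d L mv kk hL) hU hη hg hA hD hQ μ
        have hle : Fintype.card ι * (@basisConst ι _ (Matrix mm mm ℂ) Matrix.frobeniusNormedAddCommGroup Matrix.frobeniusNormedSpace e * (2 * Real.sqrt (Fintype.card mm)) *
            (Real.sqrt (Fintype.card mm) * (((((L ^ kk : ℕ) : ℝ))⁻¹) * (C / ξ) * Real.exp (((((L ^ kk : ℕ) : ℝ))⁻¹) * (C / ξ))))) ≤ rV * ((((L ^ kk : ℕ) : ℝ))⁻¹) := by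
          have e1 : Fintype.card ι * (@basisConst ι _ (Matrix mm mm ℂ) Matrix.frobeniusNormedAddCommGroup Matrix.frobeniusNormedSpace e * (2 * Real.sqrt (Fintype.card mm)) *
              (Real.sqrt (Fintype.card mm) * (((((L ^ kk : ℕ) : ℝ))⁻¹) * (C / ξ) * Real.exp (((((L ^ kk : ℕ) : ℝ))⁻¹) * (C / ξ))))) =
              ((((L ^ kk : ℕ) : ℝ))⁻¹) * (Fintype.card ι * (@basisConst ι _ (Matrix mm mm ℂ) Matrix.frobeniusNormedAddCommGroup Matrix.frobeniusNormedSpace e * (2 * Real.sqrt (Fintype.card mm)) *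
                (Real.sqrt (Fintype.card mm) * ((C / ξ) * Real.exp (((((L ^ kk : ℕ) : ℝ))⁻¹) * (C / ξ)))))) := by ring
          rw [e1, mul_comm rV]
          exact mul_le_mul_of_nonneg_left hrA hη.le
        exact ⟨fun i => (hr i).trans hle, fun j => (hc j).trans hle⟩
      have h1 : cvaStair (cvM d L mv kk hL) (L ^ kk) (fun μ b => (fun (_ : Fin (d + 1)) (_ : ScX d L mv kk hL) => (1 : Matrix ι ι ℝ)) μ b.1) y a 0 = 1 := cvaStair_one _ _ y a 0
      have hrow := fun i => rows_cvaStair_sub_one_le_of_blockOf ι hηrV y (fun μ x' hx' i => ((hT μ x' hx').1 i)) a 0 i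
      have hcol := fun j => cols_cvaStair_sub_one_le_of_blockOf ι hηrV y (fun μ x' hx' j => ((hT μ x' hx').2 j)) a 0 j
      have hσle : ((1 + rV * ((((L ^ kk : ℕ) : ℝ))⁻¹)) ^ ((d + 1) * L ^ kk) - 1) ≤ (if dZ y = 0 then ((1 + rV * ((((L ^ kk : ℕ) : ℝ))⁻¹)) ^ ((d + 1) * L ^ kk) - 1) + ((Fintype.card ι : ℝ) + 1) else ((1 + rV * ((((L ^ kk : ℕ) : ℝ))⁻¹)) ^ ((d + 1) * L ^ kk) - 1)) := by
        split_ifs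
        · linarith only [Nat.cast_nonneg (α := ℝ) (Fintype.card ι)]
        · exact le_rfl
      rw [h1]
      exact ⟨fun i => (hrow i).trans hσle, fun j => (hcol j).trans hσle⟩
  have hσ0 : ∀ y : Tor (cvM d L mv kk hL), 0 ≤ (if dZ y = 0 then ((1 + rV * ((((L ^ kk : ℕ) : ℝ))⁻¹)) ^ ((d + 1) * L ^ kk) - 1) + ((Fintype.card ι : ℝ) + 1) else ((1 + rV * ((((L ^ kk : ℕ) : ℝ))⁻¹)) ^ ((d + 1) * L ^ kk) - 1)) := fun y => by
    split_ifs
    · positivity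
    · exact hSIG0
  have hσf : ∀ y : Tor (cvM d L mv kk hL), (if dZ y = 0 then ((1 + rV * ((((L ^ kk : ℕ) : ℝ))⁻¹)) ^ ((d + 1) * L ^ kk) - 1) + ((Fintype.card ι : ℝ) + 1) else ((1 + rV * ((((L ^ kk : ℕ) : ℝ))⁻¹)) ^ ((d + 1) * L ^ kk) - 1)) ≤
      (((1 + rV * ((((L ^ kk : ℕ) : ℝ))⁻¹)) ^ ((d + 1) * L ^ kk) - 1) + ((Fintype.card ι : ℝ) + 1) * Real.exp (-((3 * δ₁ / 128) * dZ y))) * 1 := fun y => by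
    split_ifs with h
    · rw [h, mul_zero, neg_zero, Real.exp_zero, mul_one, mul_one]
    · rw [mul_one]; exact le_add_of_nonneg_right (by positivity)
  have hRR : HasMaj (BlockNorm.ofBlocks (unitTorusGeo L kk (cvM d L mv kk hL)) (liftBlk (fun y : Tor (cvM d L mv kk hL) => y) ι)) (ScNorm d L mv kk hL ι) (Matrix.mulVecLin (csavg (cvM d L mv kk hL) (L ^ kk) (cvT e (fun μ x => (U μ x : Matrix mm mm ℂ))))ᵀ - Matrix.mulVecLin (csavg (cvM d L mv kk hL) (L ^ kk) (fun (_ : Fin (d + 1)) (_ : ScX d L mv kk hL) => (1 : Matrix ι ι ℝ)))ᵀ)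
      (fun y y' => (((1 + rV * ((((L ^ kk : ℕ) : ℝ))⁻¹)) ^ ((d + 1) * L ^ kk) - 1) + ((Fintype.card ι : ℝ) + 1) * Real.exp (-((3 * δ₁ / 128) * dZ y))) * (((((L ^ kk : ℕ) : ℝ)) ^ (d + 1))⁻¹ * Real.exp (-(δ₀ * (unitTorusGeo L kk (cvM d L mv kk hL)).dist y y')))) := by
    have h := hasMaj_csavg_sub_transpose_at (cvM d L mv kk hL) (L ^ kk) L kk (cvT e (fun μ x => (U μ x : Matrix mm mm ℂ))) hσ0 (fun y a j => (hletter y a).2 j)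
    rw [Matrix.transpose_sub, mulVecLin_sub'] at h
    have h2 : HasMaj (BlockNorm.ofBlocks (unitTorusGeo L kk (cvM d L mv kk hL)) (liftBlk (fun y : Tor (cvM d L mv kk hL) => y) ι)) (ScNorm d L mv kk hL ι) (Matrix.mulVecLin (csavg (cvM d L mv kk hL) (L ^ kk) (cvT e (fun μ x => (U μ x : Matrix mm mm ℂ))))ᵀ - Matrix.mulVecLin (csavg (cvM d L mv kk hL) (L ^ kk) (fun (_ : Fin (d + 1)) (_ : ScX d L mv kk hL) => (1 : Matrix ι ι ℝ)))ᵀ) (fun w w' => if w = w' then (fun w => ((((L ^ kk : ℕ) : ℝ)) ^ (d + 1))⁻¹ * (if dZ w = 0 then ((1 + rV * ((((L ^ kk : ℕ) : ℝ))⁻¹)) ^ ((d + 1) * L ^ kk) - 1) + ((Fintype.card ι : ℝ) + 1) else ((1 + rV * ((((L ^ kk : ℕ) : ℝ))⁻¹)) ^ ((d + 1) * L ^ kk) - 1))) w else 0) := h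
    refine HasMaj.diag_weight_exp dZ δ₀ hd0 hSIG0 (by positivity : (0:ℝ) ≤ (Fintype.card ι : ℝ) + 1) (inv_nonneg.2 hnpos.le) (c := 3 * δ₁ / 128) (fun w => ?_) h2
    show ((((L ^ kk : ℕ) : ℝ)) ^ (d + 1))⁻¹ * (if dZ w = 0 then ((1 + rV * ((((L ^ kk : ℕ) : ℝ))⁻¹)) ^ ((d + 1) * L ^ kk) - 1) + ((Fintype.card ι : ℝ) + 1) else ((1 + rV * ((((L ^ kk : ℕ) : ℝ))⁻¹)) ^ ((d + 1) * L ^ kk) - 1)) ≤ _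
    have := mul_le_mul_of_nonneg_left (hσf w) (inv_nonneg.2 hnpos.le)
    rw [mul_one] at this
    exact this.trans (le_of_eq (mul_comm _ _))
  -- `E = (D G′)·Q′ᵀ` as compositions
  have hE : Matrix.mulVecLin (cE (cvM d L mv kk hL) (L ^ kk) (cvT e (fun μ x => (U μ x : Matrix mm mm ℂ))) (aK a₀ (L : ℝ) kk * (((L ^ kk : ℕ) : ℝ)) ^ (d + 1))) = Matrix.mulVecLin (cgrad (cvM d L mv kk hL) (L ^ kk) (cvT e (fun μ x => (U μ x : Matrix mm mm ℂ))) * cGreen (cvM d L mv kk hL) (L ^ kk) (cvT e (fun μ x => (U μ x : Matrix mm mm ℂ))) (aK a₀ (L : ℝ) kk * (((L ^ kk : ℕ) : ℝ)) ^ (d + 1))) ∘ₗ Matrix.mulVecLin (csavg (cvM d L mv kk hL) (L ^ kk) (cvT e (fun μ x => (U μ x : Matrix mm mm ℂ))))ᵀ := by rw [cE, Matrix.mulVecLin_mul]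
  have hE₁ : Matrix.mulVecLin (cE (cvM d L mv kk hL) (L ^ kk) (fun (_ : Fin (d + 1)) (_ : ScX d L mv kk hL) => (1 : Matrix ι ι ℝ)) (aK a₀ (L : ℝ) kk * (((L ^ kk : ℕ) : ℝ)) ^ (d + 1))) = Matrix.mulVecLin (cgrad (cvM d L mv kk hL) (L ^ kk) (fun (_ : Fin (d + 1)) (_ : ScX d L mv kk hL) => (1 : Matrix ι ι ℝ)) * cGreen (cvM d L mv kk hL) (L ^ kk) (fun (_ : Fin (d + 1)) (_ : ScX d L mv kk hL) => (1 : Matrix ι ι ℝ)) (aK a₀ (L : ℝ) kk * (((L ^ kk : ℕ) : ℝ)) ^ (d + 1))) ∘ₗ Matrix.mulVecLin (csavg (cvM d L mv kk hL) (L ^ kk) (fun (_ : Fin (d + 1)) (_ : ScX d L mv kk hL) => (1 : Matrix ι ι ℝ)))ᵀ := by rw [cE, Matrix.mulVecLin_mul]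
  have hκS : (ScNorm d L mv kk hL ι).κ = 1 := kappa_ofBlocks _
  have hrow1 : HasMaj (BlockNorm.ofBlocks (unitTorusGeo L kk (cvM d L mv kk hL)) (liftBlk (fun y : Tor (cvM d L mv kk hL) => y) ι)) (BlockNorm.ofBlocks (unitTorusGeo L kk (cvM d L mv kk hL)) (liftBlk (fun b : ScX d L mv kk hL × Fin (d + 1) => blockOf (L ^ kk) (cvM d L mv kk hL) b.1) ι)) (Matrix.mulVecLin (cE (cvM d L mv kk hL) (L ^ kk) (cvT e (fun μ x => (U μ x : Matrix mm mm ℂ))) (aK a₀ (L : ℝ) kk * (((L ^ kk : ℕ) : ℝ)) ^ (d + 1)))) (fun y y' => (ScNorm d L mv kk hL ι).κ * BL * (((((L ^ kk : ℕ) : ℝ)) ^ (d + 1))⁻¹ * τ) * cr * Real.exp (-((δ₀ - m) * (unitTorusGeo L kk (cvM d L mv kk hL)).dist y y'))) := by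
    rw [hE]; exact B11SectG.hasMaj_comp_exp htri hd hrow hBL0 (mul_nonneg (inv_nonneg.2 hnpos.le) hτ0) (by linarith only [hm8, hδ₀]) (by linarith only [hm]) (le_of_eq (by ring)) hL2 hR
  have hrow2 : HasMaj (BlockNorm.ofBlocks (unitTorusGeo L kk (cvM d L mv kk hL)) (liftBlk (fun y : Tor (cvM d L mv kk hL) => y) ι)) (BlockNorm.ofBlocks (unitTorusGeo L kk (cvM d L mv kk hL)) (liftBlk (fun b : ScX d L mv kk hL × Fin (d + 1) => blockOf (L ^ kk) (cvM d L mv kk hL) b.1) ι)) (Matrix.mulVecLin (cE (cvM d L mv kk hL) (L ^ kk) (fun (_ : Fin (d + 1)) (_ : ScX d L mv kk hL) => (1 : Matrix ι ι ℝ)) (aK a₀ (L : ℝ) kk * (((L ^ kk : ℕ) : ℝ)) ^ (d + 1)))) (fun y y' => (ScNorm d L mv kk hL ι).κ * BL * (((((L ^ kk : ℕ) : ℝ)) ^ (d + 1))⁻¹ * τ) * cr * Real.exp (-((δ₀ - m) * (unitTorusGeo L kk (cvM d L mv kk hL)).dist y y'))) := by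
    rw [hE₁]; exact B11SectG.hasMaj_comp_exp htri hd hrow hBL0 (mul_nonneg (inv_nonneg.2 hnpos.le) hτ0) (by linarith only [hm8, hδ₀]) (by linarith only [hm]) (le_of_eq (by ring)) hL2₁ hR₁
  -- the difference: `E − E₁ = (L − L₁)∘Q′(U)ᵀ + L₁∘(Q′(U)ᵀ − Q′(𝟙)ᵀ)` (weights at the output resp. at the middle: n15-c∕297's two kernels)
  have hsplit : Matrix.mulVecLin (cE (cvM d L mv kk hL) (L ^ kk) (cvT e (fun μ x => (U μ x : Matrix mm mm ℂ))) (aK a₀ (L : ℝ) kk * (((L ^ kk : ℕ) : ℝ)) ^ (d + 1))) - Matrix.mulVecLin (cE (cvM d L mv kk hL) (L ^ kk) (fun (_ : Fin (d + 1)) (_ : ScX d L mv kk hL) => (1 : Matrix ι ι ℝ)) (aK a₀ (L : ℝ) kk * (((L ^ kk : ℕ) : ℝ)) ^ (d + 1))) = (Matrix.mulVecLin (cgrad (cvM d L mv kk hL) (L ^ kk) (cvT e (fun μ x => (U μ x : Matrix mm mm ℂ))) * cGreen (cvM d L mv kk hL) (L ^ kk) (cvT e (fun μ x => (U μ x : Matrix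 mm mm ℂ))) (aK a₀ (L : ℝ) kk * (((L ^ kk : ℕ) : ℝ)) ^ (d + 1))) - Matrix.mulVecLin (cgrad (cvM d L mv kk hL) (L ^ kk) (fun (_ : Fin (d + 1)) (_ : ScX d L mv kk hL) => (1 : Matrix ι ι ℝ)) * cGreen (cvM d L mv kk hL) (L ^ kk) (fun (_ : Fin (d + 1)) (_ : ScX d L mv kk hL) => (1 : Matrix ι ι ℝ)) (aK a₀ (L : ℝ) kk * (((L ^ kk : ℕ) : ℝ)) ^ (d + 1)))) ∘ₗ Matrix.mulVecLin (csavg (cvM d L mv kk hL) (L ^ kk) (cvT e (fun μ x => (U μ x : Matrix mm mm ℂ))))ᵀ + Matrix.mulVecLin (cgrad (cvM d L mv kk hL) (L ^ kk) (fun (_ : Fin (d + 1)) (_ : ScX d L mv kk hL) => (1 : Matrix ι ι ℝ)) * cGreen (cvM d L mv kk hL) (L ^ kk) (fun (_ : Fin (d + 1)) (_ : ScX d L mv kk hL) => (1 : Matrix ι ι ℝ)) (aK a₀ (L : ℝ) kk * (((L ^ kk : ℕ) : ℝ)) ^ (d + 1))) ∘ₗ (Matrix.mulVecLin (csavg (cvM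 d L mv kk hL) (L ^ kk) (cvT e (fun μ x => (U μ x : Matrix mm mm ℂ))))ᵀ - Matrix.mulVecLin (csavg (cvM d L mv kk hL) (L ^ kk) (fun (_ : Fin (d + 1)) (_ : ScX d L mv kk hL) => (1 : Matrix ι ι ℝ)))ᵀ) := by
    rw [hE, hE₁, LinearMap.sub_comp, LinearMap.comp_sub]; abel
  have hd1 := hasMaj_nfW_comp_exp htri hd hrow (u := fun y => (rV * (1 + Fintype.card (Fin (d + 1) ⊕ Fin (d + 1))) + aK a₀ (L : ℝ) kk * (Fintype.card ι * (Fintype.card ι * ((1 + rV * ((((L ^ kk : ℕ) : ℝ))⁻¹)) ^ ((d + 1) * L ^ kk) - 1) ^ 2 + 2 * ((1 + rV * ((((L ^ kk : ℕ) : ℝ))⁻¹)) ^ ((d + 1) * L ^ kk) - 1))) + (((L ^ mv : ℕ) : ℝ))⁻¹) + 1 * Real.exp (-((3 * δ₁ / 128) * dZ y))) (fun y => by positivity) hBC0 (mul_nonneg (inv_nonneg.2 hnpos.le) hτ0)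
    (by linarith only [hm8, hδ₀] : (0:ℝ) ≤ δ₀ - m) (by linarith only [hm] : δ₀ - m ≤ δ₀) (by linarith only [] : δ₀ - m + m ≤ δ₀) hLL hR
  have hd2 := hasMaj_comp_nfW dZ htri hd hrow hdZl hdZ0 hBL0 (inv_nonneg.2 hnpos.le) hSIG0 (by positivity : (0:ℝ) ≤ (Fintype.card ι : ℝ) + 1) hm.le hmc
    (by linarith only [hm8, hδ₀] : (0:ℝ) ≤ δ₀ - 2 * m) (by linarith only [hm] : δ₀ - 2 * m ≤ δ₀) (by linarith only [] : δ₀ - 2 * m + m + m ≤ δ₀) hL2₁ hRR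
  rw [hκS] at hrow1 hrow2 hd1 hd2
  have hexp : ∀ y y', Real.exp (-((δ₀ - m) * (unitTorusGeo L kk (cvM d L mv kk hL)).dist y y')) ≤ Real.exp (-(m * (unitTorusGeo L kk (cvM d L mv kk hL)).dist y y')) := fun y y' => Real.exp_le_exp.mpr (by nlinarith only [hd y y', hm8, hδ₀])
  have hexp2 : ∀ y y', Real.exp (-((δ₀ - 2 * m) * (unitTorusGeo L kk (cvM d L mv kk hL)).dist y y')) ≤ Real.exp (-(m * (unitTorusGeo L kk (cvM d L mv kk hL)).dist y y')) := fun y y' => Real.exp_le_exp.mpr (by nlinarith only [hd y y', hm8, hδ₀])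
  have hexpZ : ∀ y, Real.exp (-((3 * δ₁ / 128) * dZ y)) ≤ Real.exp (-(m * dZ y)) := fun y => Real.exp_le_exp.mpr (by nlinarith only [hdZ0 y, hmc])
  have hK₁0 : 0 ≤ K₁ := by rw [hK₁]; positivity
  have hK₂0 : 0 ≤ K₂ := by rw [hK₂]; positivity
  have hK₃0 : 0 ≤ K₃ := by rw [hK₃]; positivity
  have hK₁B : K₁ ≤ Bout := by
    have : 0 ≤ K₃ * (τ + 1) := by positivity
    rw [hBout]; linarith only [this, hK₂0]
  refine ⟨hrow1.mono fun y y' => ?_, hrow2.mono fun y y' => ?_, ?_⟩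
  · calc 1 * BL * (((((L ^ kk : ℕ) : ℝ)) ^ (d + 1))⁻¹ * τ) * cr * Real.exp (-((δ₀ - m) * (unitTorusGeo L kk (cvM d L mv kk hL)).dist y y')) = K₁ * ((((L ^ kk : ℕ) : ℝ)) ^ (d + 1))⁻¹ * Real.exp (-((δ₀ - m) * (unitTorusGeo L kk (cvM d L mv kk hL)).dist y y')) := by rw [hK₁]; ring
      _ ≤ Bout * ((((L ^ kk : ℕ) : ℝ)) ^ (d + 1))⁻¹ * Real.exp (-(m * (unitTorusGeo L kk (cvM d L mv kk hL)).dist y y')) := mul_le_mul (mul_le_mul_of_nonneg_right hK₁B (inv_nonneg.2 hnpos.le)) (hexp y y') (Real.exp_nonneg _) (by positivity)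
  · calc 1 * BL * (((((L ^ kk : ℕ) : ℝ)) ^ (d + 1))⁻¹ * τ) * cr * Real.exp (-((δ₀ - m) * (unitTorusGeo L kk (cvM d L mv kk hL)).dist y y')) = K₁ * ((((L ^ kk : ℕ) : ℝ)) ^ (d + 1))⁻¹ * Real.exp (-((δ₀ - m) * (unitTorusGeo L kk (cvM d L mv kk hL)).dist y y')) := by rw [hK₁]; ring
      _ ≤ Bout * ((((L ^ kk : ℕ) : ℝ)) ^ (d + 1))⁻¹ * Real.exp (-(m * (unitTorusGeo L kk (cvM d L mv kk hL)).dist y y')) := mul_le_mul (mul_le_mul_of_nonneg_right hK₁B (inv_nonneg.2 hnpos.le)) (hexp y y') (Real.exp_nonneg _) (by positivity)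
  rw [hsplit]
  refine (hd1.add hd2).mono fun y y' => ?_
  have hN0 : 0 ≤ ((((L ^ kk : ℕ) : ℝ)) ^ (d + 1))⁻¹ := inv_nonneg.2 hnpos.le
  have ht0 : 0 ≤ Real.exp (-(m * dZ y)) := Real.exp_nonneg _
  have hS0 : 0 ≤ rV * (1 + Fintype.card (Fin (d + 1) ⊕ Fin (d + 1))) + aK a₀ (L : ℝ) kk * (Fintype.card ι * (Fintype.card ι * ((1 + rV * ((((L ^ kk : ℕ) : ℝ))⁻¹)) ^ ((d + 1) * L ^ kk) - 1) ^ 2 + 2 * ((1 + rV * ((((L ^ kk : ℕ) : ℝ))⁻¹)) ^ ((d + 1) * L ^ kk) - 1))) + ((1 + rV * ((((L ^ kk : ℕ) : ℝ))⁻¹)) ^ ((d + 1) * L ^ kk) - 1) + (((L ^ mv : ℕ) : ℝ))⁻¹ + Real.exp (-(m * dZ y)) := by positivity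
  -- term 1: `X(y)·(1·B_C·(n⁻ᵈ⁻¹τ)·c_r) = K₂·n⁻ᵈ⁻¹·X(y)` with `X ≤ S`; term 2: `(σ + (|ι|+1)e^{−md_Z})·(1·B_L·n⁻ᵈ⁻¹·c_r) ≤ K₃(τ+1)·n⁻ᵈ⁻¹·S`
  have h1 : ((rV * (1 + Fintype.card (Fin (d + 1) ⊕ Fin (d + 1))) + aK a₀ (L : ℝ) kk * (Fintype.card ι * (Fintype.card ι * ((1 + rV * ((((L ^ kk : ℕ) : ℝ))⁻¹)) ^ ((d + 1) * L ^ kk) - 1) ^ 2 + 2 * ((1 + rV * ((((L ^ kk : ℕ) : ℝ))⁻¹)) ^ ((d + 1) * L ^ kk) - 1))) + (((L ^ mv : ℕ) : ℝ))⁻¹) + 1 * Real.exp (-((3 * δ₁ / 128) * dZ y))) * (1 * BC * (((((L ^ kk : ℕ) : ℝ)) ^ (d + 1))⁻¹ * τ) * cr * Real.exp (-((δ₀ - m) * (unitTorusGeo L kk (cvM d L mv kk hL)).dist y y'))) ≤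
      K₂ * ((((L ^ kk : ℕ) : ℝ)) ^ (d + 1))⁻¹ * (rV * (1 + Fintype.card (Fin (d + 1) ⊕ Fin (d + 1))) + aK a₀ (L : ℝ) kk * (Fintype.card ι * (Fintype.card ι * ((1 + rV * ((((L ^ kk : ℕ) : ℝ))⁻¹)) ^ ((d + 1) * L ^ kk) - 1) ^ 2 + 2 * ((1 + rV * ((((L ^ kk : ℕ) : ℝ))⁻¹)) ^ ((d + 1) * L ^ kk) - 1))) + ((1 + rV * ((((L ^ kk : ℕ) : ℝ))⁻¹)) ^ ((d + 1) * L ^ kk) - 1) + (((L ^ mv : ℕ) : ℝ))⁻¹ + Real.exp (-(m * dZ y))) * Real.exp (-(m * (unitTorusGeo L kk (cvM d L mv kk hL)).dist y y')) := by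
    have hX : (rV * (1 + Fintype.card (Fin (d + 1) ⊕ Fin (d + 1))) + aK a₀ (L : ℝ) kk * (Fintype.card ι * (Fintype.card ι * ((1 + rV * ((((L ^ kk : ℕ) : ℝ))⁻¹)) ^ ((d + 1) * L ^ kk) - 1) ^ 2 + 2 * ((1 + rV * ((((L ^ kk : ℕ) : ℝ))⁻¹)) ^ ((d + 1) * L ^ kk) - 1))) + (((L ^ mv : ℕ) : ℝ))⁻¹) + 1 * Real.exp (-((3 * δ₁ / 128) * dZ y)) ≤ rV * (1 + Fintype.card (Fin (d + 1) ⊕ Fin (d + 1))) + aK a₀ (L : ℝ) kk * (Fintype.card ι * (Fintype.card ι * ((1 + rV * ((((L ^ kk : ℕ) : ℝ))⁻¹)) ^ ((d + 1) * L ^ kk) - 1) ^ 2 + 2 * ((1 + rV * ((((L ^ kk : ℕ) : ℝ))⁻¹)) ^ ((d + 1) * L ^ kk) - 1))) + ((1 + rV * ((((L ^ kk : ℕ) : ℝ))⁻¹)) ^ ((d + 1) * L ^ kk) - 1) + (((L ^ mv : ℕ) : ℝ))⁻¹ + Real.exp (-(m * dZ y)) := by linarith only [hexpZ y, hSIG0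]
    have hX0' : 0 ≤ (rV * (1 + Fintype.card (Fin (d + 1) ⊕ Fin (d + 1))) + aK a₀ (L : ℝ) kk * (Fintype.card ι * (Fintype.card ι * ((1 + rV * ((((L ^ kk : ℕ) : ℝ))⁻¹)) ^ ((d + 1) * L ^ kk) - 1) ^ 2 + 2 * ((1 + rV * ((((L ^ kk : ℕ) : ℝ))⁻¹)) ^ ((d + 1) * L ^ kk) - 1))) + (((L ^ mv : ℕ) : ℝ))⁻¹) + 1 * Real.exp (-((3 * δ₁ / 128) * dZ y)) := by positivity
    calc ((rV * (1 + Fintype.card (Fin (d + 1) ⊕ Fin (d + 1))) + aK a₀ (L : ℝ) kk * (Fintype.card ι * (Fintype.card ι * ((1 + rV * ((((L ^ kk : ℕ) : ℝ))⁻¹)) ^ ((d + 1) * L ^ kk) - 1) ^ 2 + 2 * ((1 + rV * ((((L ^ kk : ℕ) : ℝ))⁻¹)) ^ ((d + 1) * L ^ kk) - 1))) + (((L ^ mv : ℕ) : ℝ))⁻¹) + 1 * Real.exp (-((3 * δ₁ / 128) * dZ y))) * (1 * BC * (((((L ^ kk : ℕ) : ℝ)) ^ (d + 1))⁻¹ *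 τ) * cr * Real.exp (-((δ₀ - m) * (unitTorusGeo L kk (cvM d L mv kk hL)).dist y y')))
        = (K₂ * ((((L ^ kk : ℕ) : ℝ)) ^ (d + 1))⁻¹) * (((rV * (1 + Fintype.card (Fin (d + 1) ⊕ Fin (d + 1))) + aK a₀ (L : ℝ) kk * (Fintype.card ι * (Fintype.card ι * ((1 + rV * ((((L ^ kk : ℕ) : ℝ))⁻¹)) ^ ((d + 1) * L ^ kk) - 1) ^ 2 + 2 * ((1 + rV * ((((L ^ kk : ℕ) : ℝ))⁻¹)) ^ ((d + 1) * L ^ kk) - 1))) + (((L ^ mv : ℕ) : ℝ))⁻¹) + 1 * Real.exp (-((3 * δ₁ / 128) * dZ y))) * Real.exp (-((δ₀ - m) * (unitTorusGeo L kk (cvM d L mv kk hL)).dist y y'))) := by rw [hK₂]; ring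
      _ ≤ (K₂ * ((((L ^ kk : ℕ) : ℝ)) ^ (d + 1))⁻¹) * ((rV * (1 + Fintype.card (Fin (d + 1) ⊕ Fin (d + 1))) + aK a₀ (L : ℝ) kk * (Fintype.card ι * (Fintype.card ι * ((1 + rV * ((((L ^ kk : ℕ) : ℝ))⁻¹)) ^ ((d + 1) * L ^ kk) - 1) ^ 2 + 2 * ((1 + rV * ((((L ^ kk : ℕ) : ℝ))⁻¹)) ^ ((d + 1) * L ^ kk) - 1))) + ((1 + rV * ((((L ^ kk : ℕ) : ℝ))⁻¹)) ^ ((d + 1) * L ^ kk) - 1) + (((L ^ mv : ℕ) : ℝ))⁻¹ + Real.exp (-(m * dZ y))) * Real.exp (-(m * (unitTorusGeo L kk (cvM d L mv kk hL)).dist y y'))) :=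
          mul_le_mul_of_nonneg_left (mul_le_mul hX (hexp y y') (Real.exp_nonneg _) hS0) (mul_nonneg hK₂0 hN0)
      _ = _ := by ring
  have h2 : (((1 + rV * ((((L ^ kk : ℕ) : ℝ))⁻¹)) ^ ((d + 1) * L ^ kk) - 1) + ((Fintype.card ι : ℝ) + 1) * Real.exp (-(m * dZ y))) * (1 * BL * ((((L ^ kk : ℕ) : ℝ)) ^ (d + 1))⁻¹ * cr * Real.exp (-((δ₀ - 2 * m) * (unitTorusGeo L kk (cvM d L mv kk hL)).dist y y'))) ≤
      K₃ * (τ + 1) * ((((L ^ kk : ℕ) : ℝ)) ^ (d + 1))⁻¹ * (rV * (1 + Fintype.card (Fin (d + 1) ⊕ Fin (d + 1))) + aK a₀ (L : ℝ) kk * (Fintype.card ι * (Fintype.card ι * ((1 + rV * ((((L ^ kk : ℕ) : ℝ))⁻¹)) ^ ((d + 1) * L ^ kk) - 1) ^ 2 + 2 * ((1 + rV * ((((L ^ kk : ℕ) : ℝ))⁻¹)) ^ ((d + 1) * L ^ kk) - 1))) + ((1 + rV * ((((L ^ kk : ℕ) : ℝ))⁻¹)) ^ ((d + 1) * L ^ kk)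 - 1) + (((L ^ mv : ℕ) : ℝ))⁻¹ + Real.exp (-(m * dZ y))) * Real.exp (-(m * (unitTorusGeo L kk (cvM d L mv kk hL)).dist y y')) := by
    have hX : ((1 + rV * ((((L ^ kk : ℕ) : ℝ))⁻¹)) ^ ((d + 1) * L ^ kk) - 1) + ((Fintype.card ι : ℝ) + 1) * Real.exp (-(m * dZ y)) ≤ (τ + 1) * (rV * (1 + Fintype.card (Fin (d + 1) ⊕ Fin (d + 1))) + aK a₀ (L : ℝ) kk * (Fintype.card ι * (Fintype.card ι * ((1 + rV * ((((L ^ kk : ℕ) : ℝ))⁻¹)) ^ ((d + 1) * L ^ kk) - 1) ^ 2 + 2 * ((1 + rV * ((((L ^ kk : ℕ) : ℝ))⁻¹)) ^ ((d + 1) * L ^ kk) - 1))) + ((1 + rV * ((((L ^ kk : ℕ) : ℝ))⁻¹)) ^ ((d + 1) * L ^ kk) - 1) + (((L ^ mv : ℕ) : ℝ))⁻¹ + Real.exp (-(m * dZ y))) := by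
      have hτ1 : 1 ≤ τ + 1 := by rw [hτdef]; linarith only [Nat.cast_nonneg (α := ℝ) (Fintype.card ι)]
      have e1 : (τ + 1) * (rV * (1 + Fintype.card (Fin (d + 1) ⊕ Fin (d + 1))) + aK a₀ (L : ℝ) kk * (Fintype.card ι * (Fintype.card ι * ((1 + rV * ((((L ^ kk : ℕ) : ℝ))⁻¹)) ^ ((d + 1) * L ^ kk) - 1) ^ 2 + 2 * ((1 + rV * ((((L ^ kk : ℕ) : ℝ))⁻¹)) ^ ((d + 1) * L ^ kk) - 1))) + ((1 + rV * ((((L ^ kk : ℕ) : ℝ))⁻¹)) ^ ((d + 1) * L ^ kk) - 1) + (((L ^ mv : ℕ) : ℝ))⁻¹ + Real.exp (-(m * dZ y))) = (τ + 1) * (rV * (1 + Fintype.card (Fin (d + 1) ⊕ Fin (d + 1))) + aK a₀ (L : ℝ) kk * (Fintype.card ι * (Fintype.card ι * ((1 + rV * ((((L ^ kk : ℕ) : ℝ))⁻¹)) ^ ((d + 1) * L ^ kk) - 1) ^ 2 + 2 * ((1 + rV * ((((L ^ kk : ℕ) : ℝ))⁻¹)) ^ ((d + 1) * L ^ kk)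 - 1))) + (((L ^ mv : ℕ) : ℝ))⁻¹) + (τ + 1) * ((1 + rV * ((((L ^ kk : ℕ) : ℝ))⁻¹)) ^ ((d + 1) * L ^ kk) - 1) + (τ + 1) * Real.exp (-(m * dZ y)) := by ring
      have a1 : ((1 + rV * ((((L ^ kk : ℕ) : ℝ))⁻¹)) ^ ((d + 1) * L ^ kk) - 1) ≤ (τ + 1) * ((1 + rV * ((((L ^ kk : ℕ) : ℝ))⁻¹)) ^ ((d + 1) * L ^ kk) - 1) := le_mul_of_one_le_left hSIG0 hτ1
      have a2 : ((Fintype.card ι : ℝ) + 1) * Real.exp (-(m * dZ y)) ≤ (τ + 1) * Real.exp (-(m * dZ y)) := mul_le_mul_of_nonneg_right (by rw [hτdef]; linarith only []) ht0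
      have a3 : 0 ≤ (τ + 1) * (rV * (1 + Fintype.card (Fin (d + 1) ⊕ Fin (d + 1))) + aK a₀ (L : ℝ) kk * (Fintype.card ι * (Fintype.card ι * ((1 + rV * ((((L ^ kk : ℕ) : ℝ))⁻¹)) ^ ((d + 1) * L ^ kk) - 1) ^ 2 + 2 * ((1 + rV * ((((L ^ kk : ℕ) : ℝ))⁻¹)) ^ ((d + 1) * L ^ kk) - 1))) + (((L ^ mv : ℕ) : ℝ))⁻¹) := mul_nonneg (by linarith only [hτ1]) (by linarith only [hRC0, hRN0, hW0])
      rw [e1]; linarith only [a1, a2, a3]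
    have hX0' : 0 ≤ ((1 + rV * ((((L ^ kk : ℕ) : ℝ))⁻¹)) ^ ((d + 1) * L ^ kk) - 1) + ((Fintype.card ι : ℝ) + 1) * Real.exp (-(m * dZ y)) := by positivity
    calc (((1 + rV * ((((L ^ kk : ℕ) : ℝ))⁻¹)) ^ ((d + 1) * L ^ kk) - 1) + ((Fintype.card ι : ℝ) + 1) * Real.exp (-(m * dZ y))) * (1 * BL * ((((L ^ kk : ℕ) : ℝ)) ^ (d + 1))⁻¹ * cr * Real.exp (-((δ₀ - 2 * m) * (unitTorusGeo L kk (cvM d L mv kk hL)).dist y y')))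
        = (K₃ * ((((L ^ kk : ℕ) : ℝ)) ^ (d + 1))⁻¹) * ((((1 + rV * ((((L ^ kk : ℕ) : ℝ))⁻¹)) ^ ((d + 1) * L ^ kk) - 1) + ((Fintype.card ι : ℝ) + 1) * Real.exp (-(m * dZ y))) * Real.exp (-((δ₀ - 2 * m) * (unitTorusGeo L kk (cvM d L mv kk hL)).dist y y'))) := by rw [hK₃]; ring
      _ ≤ (K₃ * ((((L ^ kk : ℕ) : ℝ)) ^ (d + 1))⁻¹) * (((τ + 1) * (rV * (1 + Fintype.card (Fin (d + 1) ⊕ Fin (d + 1))) + aK a₀ (L : ℝ) kk * (Fintype.card ι * (Fintype.card ι * ((1 + rV * ((((L ^ kk : ℕ) : ℝ))⁻¹)) ^ ((d + 1) * L ^ kk) - 1) ^ 2 + 2 * ((1 + rV * ((((L ^ kk : ℕ) : ℝ))⁻¹)) ^ ((d + 1) * L ^ kk) - 1))) + ((1 + rV * ((((L ^ kk : ℕ) : ℝ))⁻¹)) ^ ((d + 1) * L ^ kk) - 1) + (((L ^ mv : ℕ) : ℝ))⁻¹ + Real.exp (-(m * dZ y)))) * Real.exp (-(m * (unitTorusGeo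 L kk (cvM d L mv kk hL)).dist y y'))) :=
          mul_le_mul_of_nonneg_left (mul_le_mul hX (hexp2 y y') (Real.exp_nonneg _) (mul_nonneg (by positivity) hS0)) (mul_nonneg hK₃0 hN0)
      _ = _ := by ring
  have hsum : K₂ + K₃ * (τ + 1) ≤ Bout := by rw [hBout]; linarith only [hK₁0]
  calc _ ≤ K₂ * ((((L ^ kk : ℕ) : ℝ)) ^ (d + 1))⁻¹ * (rV * (1 + Fintype.card (Fin (d + 1) ⊕ Fin (d + 1))) + aK a₀ (L : ℝ) kk * (Fintype.card ι * (Fintype.card ι * ((1 + rV * ((((L ^ kk : ℕ) : ℝ))⁻¹)) ^ ((d + 1) * L ^ kk) - 1) ^ 2 + 2 * ((1 + rV * ((((L ^ kk : ℕ) : ℝ))⁻¹)) ^ ((d + 1) * L ^ kk) - 1))) + ((1 + rV * ((((L ^ kk : ℕ) : ℝ))⁻¹)) ^ ((d + 1) * L ^ kk) - 1) + (((L ^ mv : ℕ) : ℝ))⁻¹ + Real.exp (-(m * dZ y))) * Real.exp (-(m * (unitTorusGeo L kk (cvM d L mv kk hL)).dist y y')) +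
        K₃ * (τ + 1) * ((((L ^ kk : ℕ) : ℝ)) ^ (d + 1))⁻¹ * (rV * (1 + Fintype.card (Fin (d + 1) ⊕ Fin (d + 1))) + aK a₀ (L : ℝ) kk * (Fintype.card ι * (Fintype.card ι * ((1 + rV * ((((L ^ kk : ℕ) : ℝ))⁻¹)) ^ ((d + 1) * L ^ kk) - 1) ^ 2 + 2 * ((1 + rV * ((((L ^ kk : ℕ) : ℝ))⁻¹)) ^ ((d + 1) * L ^ kk) - 1))) + ((1 + rV * ((((L ^ kk : ℕ) : ℝ))⁻¹)) ^ ((d + 1) * L ^ kk) - 1) + (((L ^ mv : ℕ) : ℝ))⁻¹ + Real.exp (-(m * dZ y))) * Real.exp (-(m * (unitTorusGeo L kk (cvM d L mv kk hL)).dist y y')) := add_le_add h1 h2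
    _ = (K₂ + K₃ * (τ + 1)) * (((((L ^ kk : ℕ) : ℝ)) ^ (d + 1))⁻¹ * (rV * (1 + Fintype.card (Fin (d + 1) ⊕ Fin (d + 1))) + aK a₀ (L : ℝ) kk * (Fintype.card ι * (Fintype.card ι * ((1 + rV * ((((L ^ kk : ℕ) : ℝ))⁻¹)) ^ ((d + 1) * L ^ kk) - 1) ^ 2 + 2 * ((1 + rV * ((((L ^ kk : ℕ) : ℝ))⁻¹)) ^ ((d + 1) * L ^ kk) - 1))) + ((1 + rV * ((((L ^ kk : ℕ) : ℝ))⁻¹)) ^ ((d + 1) * L ^ kk) - 1) + (((L ^ mv : ℕ) : ℝ))⁻¹ + Real.exp (-(m * dZ y))) * Real.exp (-(m * (unitTorusGeo L kk (cvM d L mv kk hL)).dist y y'))) := by ring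
    _ ≤ Bout * (((((L ^ kk : ℕ) : ℝ)) ^ (d + 1))⁻¹ * (rV * (1 + Fintype.card (Fin (d + 1) ⊕ Fin (d + 1))) + aK a₀ (L : ℝ) kk * (Fintype.card ι * (Fintype.card ι * ((1 + rV * ((((L ^ kk : ℕ) : ℝ))⁻¹)) ^ ((d + 1) * L ^ kk) - 1) ^ 2 + 2 * ((1 + rV * ((((L ^ kk : ℕ) : ℝ))⁻¹)) ^ ((d + 1) * L ^ kk) - 1))) + ((1 + rV * ((((L ^ kk : ℕ) : ℝ))⁻¹)) ^ ((d + 1) * L ^ kk) - 1) + (((L ^ mv : ℕ) : ℝ))⁻¹ + Real.exp (-(m * dZ y))) * Real.exp (-(m * (unitTorusGeo L kk (cvM d L mv kk hL)).dist y y'))) := mul_le_mul_of_nonneg_right hsum (by positivity)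
    _ = _ := by ring

end Green

end Summit.QuantumFields.YangMills.BalabanUVNodes.N15.Gluing

end
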